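import Literature.AlgebraicGeometry.HodgeTheory.FermatOddDegreeRestriction
import HarnessLib

/-!
# The character eigenspaces `V(α)`, `α ∈ 𝔄²ʳₘ`, of `H²ʳ(X²ʳₘ(ℂ); ℂ)` are non-zero (Ran 1980, Prop. 1.7 (i), existence half; Shioda 1979 §1)

Family `hodge`, layer `Literature/AlgebraicGeometry/HodgeTheory`. PROOF FILE (theorems only; no
definition, no named fact, D-0026). Z. Ran, *Cycles on Fermat hypersurfaces*, Compositio Math. 42
(1980), §1 Prop. 1.7 (i): "the character decomposition of `Pₙ(Vⁿₘ)` is `⊕ {H_χ : χ relevant}`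
with each `H_χ` 1-dimensional"; T. Shioda, Math. Ann. 245 (1979), §1 (1.3)–(1.4); N. Aoki,
J. Math. Soc. Japan 39 (1987), p. 385: "`dim V(α) = 1` for `α ∈ 𝔄ⁿₘ`". The tree proves the upper
bound `dim V(α) ≤ 1` (`FermatEigenspaceMultiplicityOne`); this file proves the EXISTENCE half in
even dimension `n = 2r`: **`V(α) ≠ 0` for every `α = (α₀, …, α₂ᵣ₊₁)` with all `αᵢ ≠ 0` and
`Σ αᵢ = 0`.**

Proof (Pham's affine model and a dimension count across the tube sequence; everything below is
proved from the tree's bricks). Let `X = X²ʳₘ`, `Z = Z_k` a coordinate hyperplane section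
(`≅ X²ʳ⁻¹ₘ`), `U = X ∖ Z` the affine piece, whose homology `H₂ᵣ(U(ℂ); ℂ)` carries for every
character `γ` of the torus `μₘ²ʳ⁺¹` non-trivial on each factor a non-zero eigenvector `E_γ`
(Pham 1965 / Milnor Thm. 9.1, `PhamBrieskorn.exists_eigenvector`, transported along the
equivariant lift `J → U(ℂ)` of the join, `FermatEigenspaceMultiplicityOne`). Push forward along
`i : U(ℂ) ↪ X(ℂ)` and pair with `H²ʳ(X(ℂ)) = ⊕_β V(β)` (Kronecker duality over `ℂ`,
`isInternal_fermatEigenspace`): a class of `V(β)` pairs non-trivially with `i_* E_γ` only if the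
chart character of `β` is `γ`, i.e. `β = (γ with β_k inserted)` (`pairing_eq_zero_or_apply_eq`).
(a) For `Σ γⱼ = 0` the only admissible such `β` has `β_k = 0`, `β ≠ 0`, so `V(β) = 0`
(`fermatEigenspace_eq_bot_of_apply_eq_zero`) and `i_* E_γ = 0`: these `E_γ`, linearly independent
(distinct characters), lie in `K = ker i_*`. (b) `K` is the image of the boundary
`H₂ᵣ₊₁(X(ℂ), U(ℂ)) → H₂ᵣ(U(ℂ))` and `H₂ᵣ₊₁(X(ℂ), U(ℂ)) ≅ H²ʳ⁻¹(Z(ℂ)) ≅ H²ʳ⁻¹(X²ʳ⁻¹ₘ(ℂ))`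
(Alexander–Lefschetz–Čech duality along the taut section, `ComplementRelativeHomologyDuality`,
`FermatCoordinateSectionPoints`), of dimension `≤ #{γ : all γⱼ ≠ 0, Σ γⱼ = 0}`
(`finrank_complexBetti_fermat_odd_le`); hence the `E_γ` of (a) SPAN `K`. (c) For the admissible
`α`, `γ = (αᵢ)_{i ≠ k}` has `Σ γⱼ = -α_k ≠ 0`, so `E_γ ∉ K` (linear independence), `i_* E_γ ≠ 0`
pairs non-trivially with some class, hence with some `V(β)`, `β_{≠k} = γ`; such `β` is `α` or has
`Σ βᵢ ≠ 0` (then `V(β) = 0`), so `V(α) ≠ 0`.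

Main statements: `fermatEigenspace_ne_bot_of_bounds` (the count, abstract in the two parity
inputs), `fermatEigenspace_ne_bot` (even dimension `2r`, `r ≥ 1`), and the curried form
`Ran1980_fermatEigenspace_ne_bot`.

## References

* [Ran1980] Z. Ran, Cycles on Fermat hypersurfaces, Compositio Math. 42 (1980) 121–142, §1
  Lemma 1.4, (1.5), Prop. 1.7 (i).
* [Shioda1979HodgeFermat] T. Shioda, The Hodge conjecture for Fermat varieties, Math. Ann. 245
  (1979) 175–184, §1.
* [Aoki1987] N. Aoki, Some new algebraic cycles on Fermat varieties, J. Math. Soc. Japan 39 (1987)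
  385–396, p. 385.
* [Milnor1968] J. Milnor, Singular Points of Complex Hypersurfaces, Ann. of Math. Studies 61
  (1968), §9 Thm. 9.1, Lemma 9.2.
* [Pham1965] F. Pham, Formules de Picard–Lefschetz généralisées et ramification des intégrales,
  Bull. Soc. Math. France 93 (1965) 333–367, §1.
* [HatcherAT2002] A. Hatcher, Algebraic Topology, CUP 2002, Thm. 2.16, §3.1 Thm. 3.2, §3.3
  Prop. 3.46.
-/

noncomputable section

open CategoryTheory AlgebraicGeometry

namespace Literature.AlgebraicGeometry.HodgeTheory

open Literature.AlgebraicGeometry.Motives Literature.AlgebraicTopology.SingularHomology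
open Literature.Geometry.ComplexAnalytic Literature.Geometry.ComplexAnalytic.PhamBrieskorn

variable {N m : ℕ}

/-! ### Simultaneous eigenvectors for distinct characters are linearly independent -/

/-- **Simultaneous eigenvectors of a family of operators `ρ(u)`, `u` in a finite group, for
pairwise distinct characters are linearly independent** (apply the averaging operator
`Σ_u ψᵢ(u)⁻¹ ρ(u)`, which kills the eigenvectors of the other characters — a non-trivial character
of a finite group sums to zero — and multiplies `Eᵢ` by the order of the group). [folklore] -/
theorem linearIndependent_of_eigenvectors {G : Type*} [Group G] [Fintype G] {W : Type*}
    [AddCommGroup W] [Module ℂ W] (ρ : G → W →ₗ[ℂ] W) {ι : Type*} {ψ : ι → (G →* ℂˣ)}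
    (hψ : Function.Injective ψ) {E : ι → W} (hE0 : ∀ i, E i ≠ 0)
    (hE : ∀ i u, ρ u (E i) = ((ψ i u : ℂˣ) : ℂ) • E i) : LinearIndependent ℂ E := by
  classical
  rw [linearIndependent_iff']
  intro s c hsum i hi
  -- the averaging operator of the character `ψ i`
  set P : W →ₗ[ℂ] W := ∑ u, (((ψ i u)⁻¹ : ℂˣ) : ℂ) • ρ u with hP
  have hPE : ∀ i', P (E i') = (if i' = i then (Fintype.card G : ℂ) else 0) • E i' := by
    intro i'
    rw [hP, LinearMap.sum_apply]
    simp_rw [LinearMap.smul_apply, hE, smul_smul]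
    rw [← Finset.sum_smul]
    congr 1
    split_ifs with h
    · subst h
      simp only [← Units.val_mul, inv_mul_cancel, Units.val_one, Finset.sum_const, Finset.card_univ,
        nsmul_eq_mul, mul_one]
    · -- `Σ_u ψᵢ(u)⁻¹ ψ_{i'}(u) = 0` for the non-trivial character `ψ_{i'} / ψᵢ`
      set χ : G →* ℂ := (Units.coeHom ℂ).comp ((ψ i)⁻¹ * ψ i') with hχ
      have hχ1 : χ ≠ 1 := by
        intro h1
        apply h
        apply hψ
        symm
        ext u : 1
        have hu := DFunLike.congr_fun h1 u
        simp only [hχ, MonoidHom.coe_comp, Function.comp_apply, MonoidHom.mul_apply,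
          MonoidHom.inv_apply, Units.coeHom_apply, MonoidHom.one_apply, Units.val_mul] at hu
        have hu' : ((ψ i u)⁻¹ * ψ i' u : ℂˣ) = 1 := Units.val_eq_one.mp (by rw [Units.val_mul]; exact hu)
        exact inv_mul_eq_one.mp hu'
      have h0 := sum_hom_units_eq_zero χ hχ1
      simp only [hχ, MonoidHom.coe_comp, Function.comp_apply, MonoidHom.mul_apply,
        MonoidHom.inv_apply, Units.coeHom_apply, Units.val_mul] at h0
      exact h0
  have h := congrArg P hsum
  rw [map_sum, map_zero] at h
  simp_rw [map_smul, hPE, smul_smul] at h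
  rw [Finset.sum_eq_single i (fun i' _ hi' ↦ by rw [if_neg hi', mul_zero, zero_smul])
    (fun hi' ↦ absurd hi hi')] at h
  rw [if_pos rfl] at h
  have hcard : (Fintype.card G : ℂ) ≠ 0 := by exact_mod_cast Fintype.card_ne_zero
  exact (mul_eq_zero.mp ((smul_eq_zero.mp h).resolve_right (hE0 i))).resolve_right hcard

/-- Over `ℂ`, a homology class pairing to zero with every cohomology class vanishes (universal
coefficients: `Hᵠ ≅ Hom(H_q, ℂ)`, and the dual separates points). [cite: HatcherAT2002, §3.1 Thm. 3.2] -/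
theorem singularHomology_eq_zero_of_forall_kroneckerPairing_eq_zero {Y : Type} [TopologicalSpace Y]
    (q : ℕ) (z : singularHomology ℂ ℂ Y q) (h : ∀ c, kroneckerPairing ℂ ℂ Y q c z = 0) : z = 0 := by
  refine (Module.forall_dual_apply_eq_zero_iff ℂ z).mp fun φ ↦ ?_
  obtain ⟨c, rfl⟩ := (kroneckerPairing_bijective_of_field ℂ Y q).2 φ
  exact h c

/-! ### The chart `U_k` of `Xᴺ⁺¹ₘ`: characters, the join, eigenvectors -/

section Chart

variable (k : Fin (N + 3))

/-- The value of the chart character `u ↦ χ_β(u₀, …, 1, …, u_{N+1})` on `(1, …, ζ, …, 1)`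
(`ζ` in slot `j`) is `ζ^{⟨β_{k.succAbove j}⟩}`. [cite: Ran1980, §1 Prop. 1.7 (i)] -/
theorem torusCharacter_mulSingle {β : Fin (N + 3) → ZMod m} {θ : Torus (fun _ : Fin (N + 2) ↦ m) →* ℂˣ}
    (hθ : ∀ u, θ u = fermatCharacter m β (fermatGroupEquiv m (Fin.insertNth k 1 u)))
    (j : Fin (N + 2)) (ζ : rootsOfUnity m ℂ) :
    θ (Pi.mulSingle j ζ) = (ζ : ℂˣ) ^ (β (k.succAbove j)).val := by
  classical
  rw [hθ]
  have h : (Fin.insertNth k (1 : rootsOfUnity m ℂ) (Pi.mulSingle j ζ) : Fin (N + 3) → rootsOfUnity m ℂ) =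
      Pi.mulSingle (k.succAbove j) ζ := insertNth_one_mulSingle k j ζ
  have h2 : fermatGroupEquiv m (Fin.insertNth k (1 : rootsOfUnity m ℂ) (Pi.mulSingle j ζ)) =
      fermatGroupSingle (k.succAbove j) ζ := by
    rw [fermatGroupSingle, ← h]
  rw [h2, fermatCharacter_fermatGroupSingle]

/-- **Two chart characters agree only if the coordinates off `k` agree**: if
`χ_β(u₀, …, 1, …, u_{N+1}) = χ_{β'}(u₀, …, 1, …, u_{N+1})` for all `u`, then
`β_{k.succAbove j} = β'_{k.succAbove j}` for all `j` (evaluate at `(1, …, ζ, …, 1)` with `ζ` a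
primitive `m`-th root of unity). [cite: Shioda1979PJA, §4] -/
theorem apply_succAbove_eq_of_torusCharacter_eq [NeZero m] {β β' : Fin (N + 3) → ZMod m}
    {θ θ' : Torus (fun _ : Fin (N + 2) ↦ m) →* ℂˣ}
    (hθ : ∀ u, θ u = fermatCharacter m β (fermatGroupEquiv m (Fin.insertNth k 1 u)))
    (hθ' : ∀ u, θ' u = fermatCharacter m β' (fermatGroupEquiv m (Fin.insertNth k 1 u)))
    (h : ∀ u, (θ u : ℂ) = (θ' u : ℂ)) (j : Fin (N + 2)) :
    β (k.succAbove j) = β' (k.succAbove j) := by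
  classical
  have hζ := Complex.isPrimitiveRoot_exp m (NeZero.ne m)
  set ζ : rootsOfUnity m ℂ := hζ.toRootsOfUnity with hζdef
  have hζ' : IsPrimitiveRoot ((ζ : ℂˣ) : ℂ) m := by simpa [hζdef] using hζ
  have hζu : IsPrimitiveRoot (ζ : ℂˣ) m := IsPrimitiveRoot.coe_units_iff.mp hζ'
  have h1 := h (Pi.mulSingle j ζ)
  rw [torusCharacter_mulSingle k hθ, torusCharacter_mulSingle k hθ'] at h1
  have h2 : (ζ : ℂˣ) ^ (β (k.succAbove j)).val = (ζ : ℂˣ) ^ (β' (k.succAbove j)).val :=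
    Units.val_injective (by simpa using h1)
  exact ZMod.val_injective m (hζu.pow_inj (ZMod.val_lt _) (ZMod.val_lt _) h2)

/-- The chart character of `β` is non-trivial on the factor `j` when `β_{k.succAbove j} ≠ 0`
(`m ≥ 1`). [cite: Shioda1979PJA, §4] -/
theorem exists_torusCharacter_mulSingle_ne_one [NeZero m] {β : Fin (N + 3) → ZMod m}
    {θ : Torus (fun _ : Fin (N + 2) ↦ m) →* ℂˣ}
    (hθ : ∀ u, θ u = fermatCharacter m β (fermatGroupEquiv m (Fin.insertNth k 1 u)))
    (j : Fin (N + 2)) (hj : β (k.succAbove j) ≠ 0) :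
    ∃ ζ : rootsOfUnity m ℂ, θ (Pi.mulSingle j ζ) ≠ 1 := by
  classical
  have hζ := Complex.isPrimitiveRoot_exp m (NeZero.ne m)
  set ζ : rootsOfUnity m ℂ := hζ.toRootsOfUnity with hζdef
  have hζ' : IsPrimitiveRoot ((ζ : ℂˣ) : ℂ) m := by simpa [hζdef] using hζ
  have hζu : IsPrimitiveRoot (ζ : ℂˣ) m := IsPrimitiveRoot.coe_units_iff.mp hζ'
  refine ⟨ζ, fun h1 ↦ hj ?_⟩
  rw [torusCharacter_mulSingle k hθ] at h1
  have hdvd : m ∣ (β (k.succAbove j)).val := (hζu.pow_eq_one_iff_dvd _).mp h1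
  rw [← ZMod.natCast_zmod_val (β (k.succAbove j))]
  exact (ZMod.natCast_eq_zero_iff _ _).mpr hdvd

variable {k}

/-- **The lift of the join into the affine piece `U_k(ℂ)` of `Xᴺ⁺¹ₘ`**: a continuous
`e : J → U_k(ℂ)` (`J` the join of `N + 2` copies of `μₘ`), injective on homology in every degree
(a homotopy equivalence followed by a homeomorphism: Pham's Lemma / Milnor Lemma 9.2,
`joinHomotopyEquivFibre`, and `fermatFibreHomeomorph`) and intertwining the coordinatewise torus
action with the diagonal symmetries `g_{(u₀,…,1,…,u_{N+1})}` restricted to `U_k(ℂ)`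
(`diagonalMap_comp_joinMap`). [cite: Milnor1968, §9 Lemma 9.2] [cite: Ran1980, §1 Lemma 1.4] -/
theorem exists_joinMap_compl (hm : m ≠ 0) (k : Fin (N + 3)) :
    ∃ e : C(join (fun _ : Fin (N + 2) ↦ m),
        complexPointsCompl (fermatHypersurface (N + 1) m) (fermatCoordHyperplane (N + 1) m k)),
      (∀ b, Function.Injective (singularHomology.map ℂ ℂ e b)) ∧
      ∀ u : Torus (fun _ : Fin (N + 2) ↦ m),
        (diagonalMapCompl k (fermatGroupEquiv m (Fin.insertNth k 1 u))).comp e =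
          e.comp (act (fun _ : Fin (N + 2) ↦ m) u : C(join (fun _ : Fin (N + 2) ↦ m), join (fun _ : Fin (N + 2) ↦ m))) := by
  have ha : ∀ i : Fin (N + 2), (fun _ : Fin (N + 2) ↦ m) i ≠ 0 := fun _ ↦ hm
  obtain ⟨e, he⟩ := exists_joinMap (n := N + 1) hm k
  refine ⟨e, fun b ↦ ?_, fun u ↦ ?_⟩
  · -- `e = φ⁻¹ ∘ incl`, `incl : J ↪ F` a homotopy equivalence, `φ` a homeomorphism
    have hincl : Function.Injective (singularHomology.map ℂ ℂ
        (⟨Set.inclusion join_subset_fibre, continuous_inclusion join_subset_fibre⟩ :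
          C(join (fun _ : Fin (N + 2) ↦ m), fibre (fun _ : Fin (N + 2) ↦ m))) b) := by
      have h := ConcreteCategory.bijective_of_isIso (singularHomology.isoOfHomotopyEquiv ℂ ℂ
        (joinHomotopyEquivFibre (fun _ : Fin (N + 2) ↦ m) ha) b).hom
      rw [singularHomology.isoOfHomotopyEquiv_hom, joinHomotopyEquivFibre_toFun] at h
      exact h.1
    have hφ : Function.Injective (singularHomology.map ℂ ℂ
        ((fermatFibreHomeomorph hm k).symm : C(fibre (fun _ : Fin (N + 2) ↦ m),
          complexPointsCompl (fermatHypersurface (N + 1) m) (fermatCoordHyperplane (N + 1) m k))) b) :=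
      ((forget (ModuleCat ℂ)).mapIso
        (singularHomology.mapIso ℂ ℂ (fermatFibreHomeomorph hm k).symm b)).toEquiv.injective
    intro y y' h
    rw [joinMap_eq hm k he, singularHomology.map_comp, ModuleCat.comp_apply,
      ModuleCat.comp_apply] at h
    exact hincl (hφ h)
  · have h := diagonalMap_comp_joinMap hm k he u
    refine ContinuousMap.ext fun z ↦ Subtype.ext ?_
    exact DFunLike.congr_fun h z

variable (k) in
/-- **Pham's eigenvectors in the homology of the affine piece**: for every character `γ` of the
torus `μₘᴺ⁺²` of the chart `U_k` with all `γⱼ ≠ 0` there is a non-zero class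
`E ∈ H_{N+1}(U_k(ℂ); ℂ)` on which the diagonal symmetries `g_{(u₀,…,1,…,u_{N+1})}` act through the
chart character of `β = (γ with 0 inserted at k)` (Milnor Thm. 9.1 / Pham: every such character
occurs in `H̃_{N+1}` of the join of `N + 2` copies of `μₘ`, `PhamBrieskorn.exists_eigenvector`).
[cite: Milnor1968, §9 Thm. 9.1] [cite: Pham1965, §1] [cite: Ran1980, §1 Prop. 1.7 (i)] -/
theorem exists_chart_eigenvector [NeZero m] {γ : Fin (N + 2) → ZMod m} (hγ : ∀ j, γ j ≠ 0)
    {ψ : Torus (fun _ : Fin (N + 2) ↦ m) →* ℂˣ}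
    (hψ : ∀ u, ψ u = fermatCharacter m (Fin.insertNth k 0 γ) (fermatGroupEquiv m (Fin.insertNth k 1 u)))
    {e : C(join (fun _ : Fin (N + 2) ↦ m),
      complexPointsCompl (fermatHypersurface (N + 1) m) (fermatCoordHyperplane (N + 1) m k))}
    (heinj : ∀ b, Function.Injective (singularHomology.map ℂ ℂ e b))
    (hecomm : ∀ u : Torus (fun _ : Fin (N + 2) ↦ m),
      (diagonalMapCompl k (fermatGroupEquiv m (Fin.insertNth k 1 u))).comp e =
        e.comp (act (fun _ : Fin (N + 2) ↦ m) u : C(join (fun _ : Fin (N + 2) ↦ m), join (fun _ : Fin (N + 2) ↦ m)))) :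
    ∃ E : singularHomology ℂ ℂ
        (complexPointsCompl (fermatHypersurface (N + 1) m) (fermatCoordHyperplane (N + 1) m k)) (N + 1),
      E ≠ 0 ∧ ∀ u, singularHomology.map ℂ ℂ
        (diagonalMapCompl k (fermatGroupEquiv m (Fin.insertNth k 1 u))) (N + 1) E = ((ψ u : ℂˣ) : ℂ) • E := by
  have ha : ∀ i : Fin (N + 2), (fun _ : Fin (N + 2) ↦ m) i ≠ 0 := fun _ ↦ NeZero.ne m
  have hnt : ∀ j : Fin (N + 2), ∃ ζ : rootsOfUnity m ℂ, ψ (Pi.mulSingle j ζ) ≠ 1 := fun j ↦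
    exists_torusCharacter_mulSingle_ne_one k hψ j (by rw [Fin.insertNth_apply_succAbove]; exact hγ j)
  obtain ⟨x, hx0, hx⟩ := PhamBrieskorn.exists_eigenvector ha ψ hnt
  refine ⟨singularHomology.map ℂ ℂ e (N + 1) x, fun h ↦ hx0 (heinj _ (by rw [h, map_zero])), fun u ↦ ?_⟩
  rw [← ModuleCat.comp_apply, ← singularHomology.map_comp, hecomm u, singularHomology.map_comp,
    ModuleCat.comp_apply]
  change singularHomology.map ℂ ℂ e (N + 1) (actRep (fun _ : Fin (N + 2) ↦ m) (N + 1) u x) = _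
  rw [hx u, map_smul]

variable (k) in
/-- **A class of `V(β)` pairs non-trivially with a `ψ`-eigenvector of `H_{N+1}(U_k(ℂ))` only if
the chart character of `β` is `ψ`** (`⟨c|_U, g_* E⟩ = ⟨g^* c|_U, E⟩`, naturality of the
Kronecker pairing). [cite: Ran1980, §1 Prop. 1.7 (i)] [cite: HatcherAT2002, §3.1 p. 201] -/
theorem pairing_eq_zero_or_character_eq {β : Fin (N + 3) → ZMod m}
    {c : complexBetti (fermatHypersurface (N + 1) m) (N + 1)} (hc : c ∈ fermatEigenspace m β (N + 1))
    {ψ : Torus (fun _ : Fin (N + 2) ↦ m) → ℂ}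
    {E : singularHomology ℂ ℂ
      (complexPointsCompl (fermatHypersurface (N + 1) m) (fermatCoordHyperplane (N + 1) m k)) (N + 1)}
    (hE : ∀ u, singularHomology.map ℂ ℂ
      (diagonalMapCompl k (fermatGroupEquiv m (Fin.insertNth k 1 u))) (N + 1) E = ψ u • E) :
    kroneckerPairing ℂ ℂ _ (N + 1)
        (complexBetti.restrictCompl (fermatHypersurface (N + 1) m) (fermatCoordHyperplane (N + 1) m k)
          (N + 1) c) E = 0 ∨
      ∀ u, ((fermatCharacter m β (fermatGroupEquiv m (Fin.insertNth k 1 u)) : ℂˣ) : ℂ) = ψ u := by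
  classical
  by_cases ht : kroneckerPairing ℂ ℂ _ (N + 1)
      (complexBetti.restrictCompl (fermatHypersurface (N + 1) m) (fermatCoordHyperplane (N + 1) m k)
        (N + 1) c) E = 0
  · exact Or.inl ht
  · refine Or.inr fun u ↦ ?_
    set a := fermatGroupEquiv m (Fin.insertNth k 1 u) with ha
    -- `g^*(c|_U) = (g^* c)|_U = χ_β(a) c|_U`
    have hnat : singularCohomology.map ℂ ℂ (diagonalMapCompl k a) (N + 1)
        (complexBetti.restrictCompl (fermatHypersurface (N + 1) m) (fermatCoordHyperplane (N + 1) m k)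
          (N + 1) c) =
        ((fermatCharacter m β a : ℂˣ) : ℂ) •
          complexBetti.restrictCompl (fermatHypersurface (N + 1) m) (fermatCoordHyperplane (N + 1) m k)
            (N + 1) c := by
      change singularCohomology.map ℂ ℂ (diagonalMapCompl k a) (N + 1)
          (singularCohomology.map ℂ ℂ (⟨Subtype.val, continuous_subtype_val⟩ :
            C(complexPointsCompl (fermatHypersurface (N + 1) m) (fermatCoordHyperplane (N + 1) m k),
              ComplexPoints (fermatHypersurface (N + 1) m))) (N + 1) c) = _
      rw [← ModuleCat.comp_apply, ← singularCohomology.map_comp, subtype_val_comp_diagonalMapCompl,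
        singularCohomology.map_comp, ModuleCat.comp_apply, (mem_fermatEigenspace_iff.mp hc) a, map_smul]
    have h1 := kroneckerPairing_map (R := ℂ) (M := ℂ) (diagonalMapCompl k a)
      (complexBetti.restrictCompl (fermatHypersurface (N + 1) m) (fermatCoordHyperplane (N + 1) m k)
        (N + 1) c) E
    rw [hnat, hE u, map_smul, map_smul, LinearMap.smul_apply, smul_eq_mul, smul_eq_mul] at h1
    have h2 : (((fermatCharacter m β a : ℂˣ) : ℂ) - ψ u) *
        kroneckerPairing ℂ ℂ _ (N + 1)
          (complexBetti.restrictCompl (fermatHypersurface (N + 1) m)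
            (fermatCoordHyperplane (N + 1) m k) (N + 1) c) E = 0 := by
      rw [sub_mul, h1, sub_self]
    exact sub_eq_zero.mp ((mul_eq_zero.mp h2).resolve_right ht)

variable (k) in
/-- **A `ψ_γ`-eigenvector dies in `H_{N+1}(Xᴺ⁺¹ₘ(ℂ))` as soon as every `V(β)` with chart
character `γ` vanishes**: by Kronecker duality over `ℂ` it suffices that `i_* E` pair to zero with
every class, i.e. (character decomposition `Hᴺ⁺¹ = Σ_β V(β)`) with every `c ∈ V(β)`, and
`⟨c, i_* E⟩ = ⟨c|_U, E⟩` vanishes unless the chart character of `β` is `γ`.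
[cite: Ran1980, §1 Prop. 1.7 (i)] [cite: HatcherAT2002, §3.1 Thm. 3.2] -/
theorem map_incl_eq_zero_of_forall_eigenspace_eq_bot [NeZero m] {γ : Fin (N + 2) → ZMod m}
    {ψ : Torus (fun _ : Fin (N + 2) ↦ m) →* ℂˣ}
    (hψ : ∀ u, ψ u = fermatCharacter m (Fin.insertNth k 0 γ) (fermatGroupEquiv m (Fin.insertNth k 1 u)))
    {E : singularHomology ℂ ℂ
      (complexPointsCompl (fermatHypersurface (N + 1) m) (fermatCoordHyperplane (N + 1) m k)) (N + 1)}
    (hE : ∀ u, singularHomology.map ℂ ℂ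
      (diagonalMapCompl k (fermatGroupEquiv m (Fin.insertNth k 1 u))) (N + 1) E = ((ψ u : ℂˣ) : ℂ) • E)
    (hV : ∀ β : Fin (N + 3) → ZMod m, (∀ j, β (k.succAbove j) = γ j) → fermatEigenspace m β (N + 1) = ⊥) :
    singularHomology.map ℂ ℂ (⟨Subtype.val, continuous_subtype_val⟩ :
      C(complexPointsCompl (fermatHypersurface (N + 1) m) (fermatCoordHyperplane (N + 1) m k),
        ComplexPoints (fermatHypersurface (N + 1) m))) (N + 1) E = 0 := by
  classical
  apply singularHomology_eq_zero_of_forall_kroneckerPairing_eq_zero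
  intro c
  have hc : c ∈ ⨆ β : Fin (N + 3) → ZMod m, fermatEigenspace m β (N + 1) := by
    rw [iSup_fermatEigenspace_eq_top]; trivial
  refine Submodule.iSup_induction (p := fun β : Fin (N + 3) → ZMod m ↦ fermatEigenspace m β (N + 1))
    (motive := fun c ↦ kroneckerPairing ℂ ℂ _ (N + 1) c (singularHomology.map ℂ ℂ
      (⟨Subtype.val, continuous_subtype_val⟩ :
        C(complexPointsCompl (fermatHypersurface (N + 1) m) (fermatCoordHyperplane (N + 1) m k),
          ComplexPoints (fermatHypersurface (N + 1) m))) (N + 1) E) = 0) hc ?_ ?_ ?_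
  · intro β c hcβ
    rw [← kroneckerPairing_map]
    obtain ⟨θ, hθ⟩ := exists_torusCharacter_eq (n := N + 1) k β
    rcases pairing_eq_zero_or_character_eq k hcβ (ψ := fun u ↦ ((ψ u : ℂˣ) : ℂ)) hE with h0 | hchar
    · exact h0
    · -- the chart character of `β` is `ψ = ψ_γ`: `β` off `k` is `γ`, so `V(β) = 0` and `c = 0`
      have hβγ : ∀ j, β (k.succAbove j) = γ j := by
        intro j
        have h := apply_succAbove_eq_of_torusCharacter_eq k hθ hψ (fun u ↦ by rw [hθ u]; exact hchar u) j
        rw [h, Fin.insertNth_apply_succAbove]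
      have hc0 : c = 0 := by
        have h := hV β hβγ
        rw [h, Submodule.mem_bot] at hcβ
        exact hcβ
      rw [hc0, map_zero, LinearMap.map_zero₂]
  · rw [LinearMap.map_zero₂]
  · intro x y hx hy
    rw [LinearMap.map_add₂, hx, hy, add_zero]

end Chart

/-! ### The count -/

/-- **The dimension count (abstract in the two parity inputs).** Let `X = Xᴺ⁺¹ₘ` (`N, m ≥ 1`),
`k` a coordinate, and suppose
(H1) `V(β) ⊆ Hᴺ⁺¹(X(ℂ); ℂ)` vanishes for every `β ≠ 0` with `β_k = 0`;
(H2) `dim Hᴺ(Xᴺₘ(ℂ); ℂ) ≤ #{γ ∈ (ℤ/m)ᴺ⁺² : all γⱼ ≠ 0, Σ γⱼ = 0}`.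
Then `V(α) ≠ 0` for every `α` with all `αᵢ ≠ 0` and `Σ αᵢ = 0`. Proof: the Pham eigenvectors
`E_γ ∈ H_{N+1}(U_k(ℂ))`, `γ` all non-zero, are linearly independent; those with `Σ γⱼ = 0` die in
`H_{N+1}(X(ℂ))` by (H1) and so span the kernel `K` of `i_*`, whose dimension is at most
`dim H_{N+2}(X(ℂ), U_k(ℂ)) = dim Hᴺ(Z_k(ℂ)) = dim Hᴺ(Xᴺₘ(ℂ))` (duality; (H2)); the eigenvector of
`γ = (αᵢ)_{i ≠ k}` (`Σ γⱼ = -α_k ≠ 0`) is therefore not in `K`, and `i_* E_γ ≠ 0` forces a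
non-zero class in `V(α)`. [cite: Ran1980, §1 Prop. 1.7 (i)] [cite: Shioda1979HodgeFermat, §1]
[cite: Milnor1968, §9 Thm. 9.1] -/
theorem fermatEigenspace_ne_bot_of_bounds [NeZero m] (hN : 1 ≤ N) (k : Fin (N + 3))
    (H1 : ∀ β : Fin (N + 3) → ZMod m, β ≠ 0 → β k = 0 → fermatEigenspace m β (N + 1) = ⊥)
    (H2 : Module.finrank ℂ (complexBetti (fermatHypersurface N m) N) ≤
      Fintype.card {t : {γ : Fin (N + 2) → ZMod m // ∀ j, γ j ≠ 0} // ∑ j, t.1 j = 0})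
    {α : Fin (N + 3) → ZMod m} (hα : ∀ i, α i ≠ 0) (hαs : ∑ i, α i = 0) :
    fermatEigenspace m α (N + 1) ≠ ⊥ := by
  classical
  have hm : m ≠ 0 := NeZero.ne m
  have hm1 : 1 ≤ m := NeZero.one_le
  -- the ambient closed oriented manifold `X(ℂ)` and the section `Z_k(ℂ)`
  have hX : IsSmoothProjective (N + 1) (fermatHypersurface (N + 1) m) :=
    isSmoothProjective_fermatHypersurface (by omega) hm1
  letI := hX.chartedSpace
  haveI := ComplexPoints.compactSpace_of_isSmoothProjective hX
  haveI := ComplexPoints.t2Space_of_isSmoothProjective hX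
  obtain ⟨μ⟩ := ComplexPoints.isOrientableOver ℂ hX
  set Kset : Set (ComplexPoints (fermatHypersurface (N + 1) m)) :=
    {P | P.pt ∈ fermatCoordHyperplane (N + 1) m k} with hKset
  have hK : IsClosed Kset := isClosed_fermatSectionPoints hm k
  obtain ⟨T⟩ := nonempty_retractionNhds_fermatSectionPoints (n := N) hm1 k
  obtain ⟨eK⟩ := nonempty_homeomorph_fermatSectionPoints (n := N) hm k
  -- the inclusion `i : U_k(ℂ) ↪ X(ℂ)`
  set incl : C(complexPointsCompl (fermatHypersurface (N + 1) m) (fermatCoordHyperplane (N + 1) m k),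
      ComplexPoints (fermatHypersurface (N + 1) m)) := ⟨Subtype.val, continuous_subtype_val⟩ with hincl
  -- characters and Pham eigenvectors for every all-non-zero `γ`
  obtain ⟨e, heinj, hecomm⟩ := exists_joinMap_compl (N := N) hm k
  have hψ : ∀ t : {γ : Fin (N + 2) → ZMod m // ∀ j, γ j ≠ 0},
      ∃ ψ : Torus (fun _ : Fin (N + 2) ↦ m) →* ℂˣ,
        ∀ u, ψ u = fermatCharacter m (Fin.insertNth k 0 t.1) (fermatGroupEquiv m (Fin.insertNth k 1 u)) :=
    fun t ↦ exists_torusCharacter_eq (n := N + 1) k _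
  choose ψ hψ using hψ
  have hE : ∀ t : {γ : Fin (N + 2) → ZMod m // ∀ j, γ j ≠ 0},
      ∃ E : singularHomology ℂ ℂ
        (complexPointsCompl (fermatHypersurface (N + 1) m) (fermatCoordHyperplane (N + 1) m k)) (N + 1),
        E ≠ 0 ∧ ∀ u, singularHomology.map ℂ ℂ
          (diagonalMapCompl k (fermatGroupEquiv m (Fin.insertNth k 1 u))) (N + 1) E = ((ψ t u : ℂˣ) : ℂ) • E :=
    fun t ↦ exists_chart_eigenvector k t.2 (hψ t) heinj hecomm
  choose E hE0 hE using hE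
  -- distinct characters, hence linear independence
  have hψinj : Function.Injective ψ := by
    intro t t' h
    refine Subtype.ext (funext fun j ↦ ?_)
    have hj := apply_succAbove_eq_of_torusCharacter_eq k (hψ t) (hψ t') (fun u ↦ by rw [h]) j
    rwa [Fin.insertNth_apply_succAbove, Fin.insertNth_apply_succAbove] at hj
  haveI : Fintype (Torus (fun _ : Fin (N + 2) ↦ m)) := Fintype.ofFinite _
  have hlin : LinearIndependent ℂ E :=
    linearIndependent_of_eigenvectors
      (fun u ↦ (singularHomology.map ℂ ℂ
        (diagonalMapCompl k (fermatGroupEquiv m (Fin.insertNth k 1 u))) (N + 1)).hom)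
      hψinj hE0 (fun t u ↦ hE t u)
  -- the kernel of `i_*` and the eigenvectors with `Σ γ = 0`
  set K := LinearMap.ker (singularHomology.map ℂ ℂ incl (N + 1)).hom with hKdef
  set S₀ : Set {γ : Fin (N + 2) → ZMod m // ∀ j, γ j ≠ 0} := {t | ∑ j, t.1 j = 0} with hS₀
  have hS₀K : ∀ t ∈ S₀, E t ∈ K := by
    intro t ht
    rw [hKdef, LinearMap.mem_ker]
    refine map_incl_eq_zero_of_forall_eigenspace_eq_bot k (hψ t) (hE t) fun β hβ ↦ ?_
    by_cases hs : ∑ i, β i = 0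
    · -- `β_k = Σ β - Σ γ = 0`, `β ≠ 0`
      refine H1 β ?_ ?_
      · intro h0
        apply t.2 0
        simpa [h0] using (hβ 0).symm
      · rw [Fin.sum_univ_succAbove β k] at hs
        simp only [hβ] at hs
        change β k + ∑ j, t.1 j = 0 at hs
        rw [show (∑ j, t.1 j) = 0 from ht, add_zero] at hs
        exact hs
    · exact fermatEigenspace_eq_bot_of_sum_ne_zero hs _
  have hspan : Submodule.span ℂ (E '' S₀) ≤ K :=
    Submodule.span_le.mpr (by rintro _ ⟨t, ht, rfl⟩; exact hS₀K t ht)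
  -- `dim K ≤ dim Hᴺ(Z_k(ℂ)) = dim Hᴺ(Xᴺₘ(ℂ)) ≤ #S₀`
  haveI := finite_complexBetti (isSmoothProjective_fermatHypersurface hN hm1) N
  haveI : Module.Finite ℂ (singularCohomology ℂ ℂ (↥Kset) N) :=
    Module.Finite.equiv (singularCohomology.mapIso ℂ ℂ eK N).toLinearEquiv.symm
  obtain ⟨hKfg, hKle⟩ := relativeSingularHomology.finrank_ker_map_le μ hK T (p := N) (q := N + 1)
    (by ring)
  have hKle' : Module.finrank ℂ K ≤ Fintype.card ↥S₀ := by
    refine hKle.trans ?_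
    rw [(singularCohomology.mapIso ℂ ℂ eK N).toLinearEquiv.finrank_eq]
    refine H2.trans (le_of_eq (Fintype.card_congr (Equiv.refl _)))
  -- hence the `E_γ`, `Σ γ = 0`, span `K`
  have hrank : Module.finrank ℂ (Submodule.span ℂ (E '' S₀)) = Fintype.card ↥S₀ := by
    rw [show E '' S₀ = Set.range (E ∘ ((↑) : ↥S₀ → _)) by
      rw [Set.range_comp, Subtype.range_coe]]
    exact finrank_span_eq_card (hlin.comp _ Subtype.val_injective)
  haveI : FiniteDimensional ℂ K := Module.Finite.iff_fg.mpr hKfg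
  have heq : Submodule.span ℂ (E '' S₀) = K :=
    Submodule.eq_of_le_of_finrank_le hspan (by rw [hrank]; exact hKle')
  -- the eigenvector of `γ = (αᵢ)_{i ≠ k}` is not in `K`
  set t₁ : {γ : Fin (N + 2) → ZMod m // ∀ j, γ j ≠ 0} := ⟨fun j ↦ α (k.succAbove j), fun j ↦ hα _⟩
    with ht₁def
  have ht₁ : t₁ ∉ S₀ := by
    intro h
    apply hα k
    have hsum := Fin.sum_univ_succAbove α k
    rw [hαs] at hsum
    change (0 : ZMod m) = α k + ∑ j, t₁.1 j at hsum
    rw [show (∑ j, t₁.1 j) = 0 from h, add_zero] at hsum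
    exact hsum.symm
  have hnot : E t₁ ∉ K := by
    rw [← heq]
    exact hlin.notMem_span_image ht₁
  rw [hKdef, LinearMap.mem_ker] at hnot
  -- so `i_* E_{t₁} ≠ 0`: some `V(β)` with chart character `t₁` is non-zero, and it is `V(α)`
  intro hbot
  apply hnot
  refine map_incl_eq_zero_of_forall_eigenspace_eq_bot k (hψ t₁) (hE t₁) fun β hβ ↦ ?_
  by_cases hs : ∑ i, β i = 0
  · -- `β = α`
    have hβα : β = α := by
      funext i
      refine Fin.succAboveCases k ?_ (fun j ↦ hβ j) i
      rw [Fin.sum_univ_succAbove β k] at hs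
      have hs' := hαs
      rw [Fin.sum_univ_succAbove α k] at hs'
      simp only [hβ] at hs
      change β k + ∑ j, α (k.succAbove j) = 0 at hs
      have : β k = α k := by
        have h3 : β k + ∑ j, α (k.succAbove j) = α k + ∑ j, α (k.succAbove j) := by rw [hs, hs']
        exact add_right_cancel h3
      exact this
    rw [hβα]
    exact hbot
  · exact fermatEigenspace_eq_bot_of_sum_ne_zero hs _

/-- **`V(α) ≠ 0` for every admissible character in the middle cohomology of the
even-dimensional Fermat variety** (`r ≥ 1`, `m ≥ 1`): for `α = (α₀, …, α₂ᵣ₊₁) ∈ (ℤ/m)²ʳ⁺²` with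
all `αᵢ ≠ 0` and `Σ αᵢ = 0`, the eigenspace `V(α) ⊆ H²ʳ(X²ʳₘ(ℂ); ℂ)` of `χ_α` is non-zero — the
existence half of Ran's Prop. 1.7 (i) / Shioda's "`dim V(α) = 1` for `α ∈ 𝔄ⁿₘ`" (the bound
`≤ 1` is the tree's `Ran1980_fermatEigenspace_le_span_holds`). From
`fermatEigenspace_ne_bot_of_bounds` with the even-dimensional vanishing
`fermatEigenspace_eq_bot_of_apply_eq_zero` and the odd-dimensional Betti bound
`finrank_complexBetti_fermat_odd_le` for the section `X²ʳ⁻¹ₘ`. [cite: Ran1980, §1 Prop. 1.7 (i)]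
[cite: Shioda1979HodgeFermat, §1] [cite: Aoki1987, p. 385 (dim V(α) = 1)] -/
theorem fermatEigenspace_ne_bot [NeZero m] {r : ℕ} (hr : 1 ≤ r) {α : Fin (2 * r + 2) → ZMod m}
    (hα : ∀ i, α i ≠ 0) (hαs : ∑ i, α i = 0) : fermatEigenspace m α (2 * r) ≠ ⊥ := by
  obtain ⟨s, rfl⟩ : ∃ s, r = s + 1 := ⟨r - 1, by omega⟩
  have hm1 : 1 ≤ m := NeZero.one_le
  have H1 : ∀ β : Fin (2 * s + 1 + 3) → ZMod m, β ≠ 0 → β 0 = 0 →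
      fermatEigenspace m β (2 * s + 1 + 1) = ⊥ :=
    fun β hβ hβ0 ↦ fermatEigenspace_eq_bot_of_apply_eq_zero (r := s + 1) hm1 (by omega) hβ hβ0
  have H2 : Module.finrank ℂ (complexBetti (fermatHypersurface (2 * s + 1) m) (2 * s + 1)) ≤
      Fintype.card {t : {γ : Fin (2 * s + 1 + 2) → ZMod m // ∀ j, γ j ≠ 0} // ∑ j, t.1 j = 0} := by
    refine (finrank_complexBetti_fermat_odd_le (m := m) s).trans (le_of_eq ?_)
    exact Fintype.card_congr (Equiv.subtypeSubtypeEquivSubtypeInter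
      (fun γ : Fin (2 * s + 3) → ZMod m ↦ ∀ j, γ j ≠ 0) (fun γ ↦ ∑ j, γ j = 0)).symm
  exact fermatEigenspace_ne_bot_of_bounds (N := 2 * s + 1) (by omega) 0 H1 H2 hα hαs

/-- **Ran 1980, Prop. 1.7 (i), existence half, in the curried form consumed downstream**
(hypothesis `hE` of `claimLevelPull_of_exists_eigenclass`; the missing input "`V(β) ≠ 0`" of
the cone-span leaves of Aoki's Thm. 1-4 (i)). [cite: Ran1980, §1 Prop. 1.7 (i)]
[cite: Shioda1979HodgeFermat, §1] -/
theorem Ran1980_fermatEigenspace_ne_bot :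
    ∀ (m r : ℕ) [NeZero m] (α : Fin (2 * r + 2) → ZMod m), 1 ≤ r → (∀ i, α i ≠ 0) →
      ∑ i, α i = 0 → fermatEigenspace m α (2 * r) ≠ ⊥ :=
  fun _ _ _ _ hr hα hαs ↦ fermatEigenspace_ne_bot hr hα hαs

end Literature.AlgebraicGeometry.HodgeTheory

end
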